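import Mathlib
import Literature.MathematicalPhysics.QuantumLattice.HubbardTruncatedCoeffThermodynamicLimit
import Summits.HubbardSuperconductivity.HubbardSuperconductivity.Theorems.KLProgrammeH10RungCompactBoxParamDecay
import HarnessLib

/-!
# Route KLProgramme — support item R0′ `H10RungCompactBox`, helper 2/4: decay of the free Hubbard
propagator UNIFORM on compact boxes of `(τ, β, μ)`

The tree (`HubbardFreePropagatorTorusDecay`, `HubbardTruncatedCoeffThermodynamicLimit`) proves
`|g_{β,μ}(τ, z)| ≤ C (1 + |z|)^{-K}` with `C = C(β, μ, [a, b], K)` uniform in the time separation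
`τ ∈ [a, b]`, and the corresponding uniform-in-`L` torus bound. Here the SAME chain is re-run with the
three parameters `(τ, β, μ)` ranging over a compact box `[a, b] × [0, B] × [μa, μb]` and ONE constant:
`h10rung_contDiff_symbol` (the symbol `e^{-τE} f_β(E)` is jointly `C^∞` in `(τ, β, μ, y)`),
`h10rung_uniform_decay_freePropagator` (uniform decay of `freePropagatorInfiniteTime`, through the
parameter-family decay lemma `paramTorus_exists_hasDecay_mFourierCoeff`),
`h10rung_norm_free_twoPoint_le_box` (uniform-in-`L` decay of the free torus propagator in the torus norm,
copies of `exists_norm_hubbardThermalTwoPointEvolved_zero_interaction_le_of_Icc{,'}` and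
`exists_norm_hubbardThermalTwoPointEvolved_le_tnZ` with `β, μ` quantified inside). Source of the scheme:
Benfatto–Giuliani–Mastropietro 2006, §2.2 (bounds uniform in the parameters and in `L`).
-/

noncomputable section

-- the tree's namespace `Summit.<Summit>.<Problem>.Theorems` repeats the summit name by design (D-0017)
set_option linter.dupNamespace false

open MeasureTheory Set Filter Topology UnitAddTorus
open scoped ContDiff
open Literature.Probability.LatticeModels
open Literature.MathematicalPhysics.QuantumLattice
open Literature.Analysis.FunctionSpaces.Torus (proj)

namespace Summit.HubbardSuperconductivity.HubbardSuperconductivity.Theorems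

/-! ### Joint smoothness of the free symbol in `(τ, β, μ)` and momentum -/

/-- **The free symbol `(τ, β, μ; y) ↦ e^{-τE_μ(y)} f_β(E_μ(y))`, `E_μ(y) = -2Σcos 2πyᵢ - μ`, is jointly
`C^∞`** on `(ℝ × ℝ × ℝ) × ℝ^d` (parameters `q = (τ, β, μ)`). -/
theorem h10rung_contDiff_symbol {d : ℕ} :
    ContDiff ℝ ∞ (fun z : (ℝ × ℝ × ℝ) × EuclideanSpace ℝ (Fin d) =>
      hubbardFreeSymbolTime (d := d) z.1.2.1 z.1.2.2 (z.1.1 : ℂ) (proj z.2)) := by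
  have hfun : (fun z : (ℝ × ℝ × ℝ) × EuclideanSpace ℝ (Fin d) =>
      hubbardFreeSymbolTime (d := d) z.1.2.1 z.1.2.2 (z.1.1 : ℂ) (proj z.2)) =
      fun z : (ℝ × ℝ × ℝ) × EuclideanSpace ℝ (Fin d) =>
        Complex.exp (-(z.1.1 : ℂ) * (((-2 * ∑ i, Real.cos (2 * Real.pi * z.2 i) - z.1.2.2 : ℝ)) : ℂ)) *
          ((fermiFunction z.1.2.1 (-2 * ∑ i, Real.cos (2 * Real.pi * z.2 i) - z.1.2.2) : ℝ) : ℂ) := by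
    funext z
    exact hubbardFreeSymbolTime_coe z.1.2.1 z.1.2.2 (z.1.1 : ℂ) (fun i => z.2 i)
  rw [hfun]
  have hband : ContDiff ℝ ∞ (fun z : (ℝ × ℝ × ℝ) × EuclideanSpace ℝ (Fin d) =>
      (-2 * ∑ i, Real.cos (2 * Real.pi * z.2 i) - z.1.2.2 : ℝ)) := by
    refine ContDiff.sub (contDiff_const.mul (ContDiff.sum fun i _ => ?_))
      (contDiff_snd.comp (contDiff_snd.comp contDiff_fst))
    exact Real.contDiff_cos.comp (contDiff_const.mul ((contDiff_piLp_apply 2).comp contDiff_snd))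
  have hβ : ContDiff ℝ ∞ (fun z : (ℝ × ℝ × ℝ) × EuclideanSpace ℝ (Fin d) => z.1.2.1) :=
    contDiff_fst.comp (contDiff_snd.comp contDiff_fst)
  have hτ : ContDiff ℝ ∞ (fun z : (ℝ × ℝ × ℝ) × EuclideanSpace ℝ (Fin d) => (z.1.1 : ℂ)) :=
    Complex.ofRealCLM.contDiff.comp (contDiff_fst.comp contDiff_fst)
  have hfermi : ContDiff ℝ ∞ (fun z : (ℝ × ℝ × ℝ) × EuclideanSpace ℝ (Fin d) =>
      fermiFunction z.1.2.1 (-2 * ∑ i, Real.cos (2 * Real.pi * z.2 i) - z.1.2.2)) := by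
    unfold fermiFunction
    simp_rw [one_div]
    refine ContDiff.inv (contDiff_const.add (Real.contDiff_exp.comp (hβ.mul hband))) fun z => ?_
    positivity
  refine ContDiff.mul ?_ (Complex.ofRealCLM.contDiff.comp hfermi)
  exact Complex.contDiff_exp.comp (hτ.neg.mul (Complex.ofRealCLM.contDiff.comp hband))

/-! ### Uniform decay of the infinite-volume free propagator -/

/-- **Uniform decay of `g_{β,μ}(τ, ·)` on compact parameter boxes**: for all reals `a, b, B, μa, μb`
and every order `K` there is `C ≥ 0` with `|g_{β,μ}(τ, z)| ≤ C (1 + |z|)^{-K}` for all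
`τ ∈ [a, b]`, `β ∈ [0, B]`, `μ ∈ [μa, μb]` and `z ∈ ℤ^d` (Benfatto–Giuliani–Mastropietro 2006 §2.2, the
tree's `exists_uniform_decay_freePropagatorInfiniteTime_Icc` with the parameter dependence tracked). -/
theorem h10rung_uniform_decay_freePropagator {d : ℕ} (a b B μa μb : ℝ) (K : ℕ) :
    ∃ C : ℝ, 0 ≤ C ∧ ∀ τ ∈ Icc a b, ∀ β ∈ Icc 0 B, ∀ μ ∈ Icc μa μb, ∀ z : Site d,
      ‖freePropagatorInfiniteTime (d := d) β μ (τ : ℂ) z‖ ≤ C * ((1 + ‖z‖) ^ K)⁻¹ := by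
  have hψ : ContDiffOn ℝ ∞ (fun z : (ℝ × ℝ × ℝ) × EuclideanSpace ℝ (Fin d) =>
      (fun q : ℝ × ℝ × ℝ => hubbardFreeSymbolTime (d := d) q.2.1 q.2.2 (q.1 : ℂ)) z.1 (proj z.2))
      ((univ : Set (ℝ × ℝ × ℝ)) ×ˢ univ) :=
    h10rung_contDiff_symbol.contDiffOn
  obtain ⟨C, hC0, hC⟩ := paramTorus_exists_hasDecay_mFourierCoeff
    (ψ := fun q : ℝ × ℝ × ℝ => hubbardFreeSymbolTime (d := d) q.2.1 q.2.2 (q.1 : ℂ)) hψ uniqueDiffOn_univ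
    (K := Icc a b ×ˢ (Icc 0 B ×ˢ Icc μa μb)) (isCompact_Icc.prod (isCompact_Icc.prod isCompact_Icc))
    (subset_univ _) K
  refine ⟨C, hC0, fun τ hτ β hβ μ hμ z => ?_⟩
  have h := hC (τ, β, μ) (mk_mem_prod hτ (mk_mem_prod hβ hμ)) (-z)
  rw [norm_neg] at h
  exact h

/-! ### Uniform-in-`L` decay of the free torus propagator on the box -/

/-- **Uniform-in-`L` decay of the free torus propagator in the torus norm of the separation, with ONE
constant on the parameter box**: for time separations in `[a, b]`, `β ∈ [0, B]`, `μ ∈ [μa, μb]` and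
`K ≥ 4` there is `C > 0` with `|⟨a⁺_{x₁σ₁}(t) a⁻_{y₁σ₂}(s)⟩_{β,L,U=0,μ}| ≤ C (1 + tnZ_L(y₁ - x₁))^{-K}`
for all `L ≥ 3` (Benfatto–Giuliani–Mastropietro 2006 §2.2 / footnote 1; the tree's
`exists_norm_hubbardThermalTwoPointEvolved_le_tnZ` with `β, μ` inside the quantifiers). -/
theorem h10rung_norm_free_twoPoint_le_box (a b B μa μb : ℝ) {K : ℕ} (hK : 4 ≤ K) :
    ∃ C : ℝ, 0 < C ∧ ∀ β ∈ Icc 0 B, ∀ μ ∈ Icc μa μb, ∀ (L : ℕ), 3 ≤ L → ∀ (t s : ℝ), s - t ∈ Icc a b →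
      ∀ (x₁ y₁ : Site 2) (σ₁ σ₂ : Fin 2),
        ‖hubbardThermalTwoPointEvolved β 0 μ L x₁ σ₁ (t : ℂ) y₁ σ₂ (s : ℂ)‖ ≤
          C * ((1 + (tnZ L (y₁ - x₁) : ℝ)) ^ K)⁻¹ := by
  obtain ⟨C₀, hC₀, hdec⟩ := h10rung_uniform_decay_freePropagator (d := 2) a b B μa μb K
  have hS := summable_inv_one_add_norm_pow (d := 2) (K := K) (by omega)
  set S : ℝ := ∑' n : Site 2, ((1 + ‖n‖) ^ K)⁻¹ with hSdef
  have hS0 : 0 ≤ S := tsum_nonneg fun n => by positivity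
  set C : ℝ := C₀ * (1 + (4 : ℝ) ^ K * S) with hCdef
  have hCnn : 0 ≤ C := by positivity
  -- the bound for every short representative
  have hrep : ∀ β ∈ Icc 0 B, ∀ μ ∈ Icc μa μb, ∀ (L : ℕ), 3 ≤ L → ∀ (t s : ℝ), s - t ∈ Icc a b →
      ∀ (x y z m : Site 2) (σ σ' : Fin 2), z = y - x + (L : ℤ) • m → 2 * ‖z‖ ≤ L →
        ‖hubbardThermalTwoPointEvolved β 0 μ L x σ (t : ℂ) y σ' (s : ℂ)‖ ≤ C * ((1 + ‖z‖) ^ K)⁻¹ := by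
    intro β hβ μ hμ L hL t s hts x y z m σ σ' hz hzL
    rw [hubbardThermalTwoPointEvolved_zero_interaction_eq_tsum_images β μ hL x y σ σ']
    split_ifs with hσ
    · rw [← tsum_translate_eq_of_eq_add_zsmul L m hz]
      have hτ : ((s : ℂ) - (t : ℂ)) = ((s - t : ℝ) : ℂ) := by push_cast; ring
      rw [hτ]
      exact norm_tsum_translate_le_of_decay hC₀ (hdec (s - t) hts β hβ μ hμ) hS (by omega) hzL
    · rw [norm_zero]; positivity
  refine ⟨C + 1, by linarith, fun β hβ μ hμ L hL t s hts x₁ y₁ σ₁ σ₂ => ?_⟩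
  haveI : NeZero L := ⟨by omega⟩
  obtain ⟨z, m, hz, hzL⟩ := exists_representative_two_mul_norm_le (d := 2) (L := L) (by omega) (y₁ - x₁)
  have hb := hrep β hβ μ hμ L hL t s hts x₁ y₁ z m σ₁ σ₂ hz hzL
  have htn : (tnZ L (y₁ - x₁) : ℝ) ≤ ‖z‖ := by
    rw [Site.norm_eq_supNorm, ← tnZ_add_zsmul L (y₁ - x₁) m, ← hz]
    exact_mod_cast tnZ_le_supNorm z
  have h0 : (0 : ℝ) ≤ tnZ L (y₁ - x₁) := Nat.cast_nonneg _
  calc ‖hubbardThermalTwoPointEvolved β 0 μ L x₁ σ₁ (t : ℂ) y₁ σ₂ (s : ℂ)‖ ≤ C * ((1 + ‖z‖) ^ K)⁻¹ := hb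
    _ ≤ C * ((1 + (tnZ L (y₁ - x₁) : ℝ)) ^ K)⁻¹ := by
        refine mul_le_mul_of_nonneg_left ?_ hCnn
        exact inv_anti₀ (by positivity) (pow_le_pow_left₀ (by positivity) (by linarith) K)
    _ ≤ (C + 1) * ((1 + (tnZ L (y₁ - x₁) : ℝ)) ^ K)⁻¹ :=
        mul_le_mul_of_nonneg_right (by linarith) (by positivity)

end Summit.HubbardSuperconductivity.HubbardSuperconductivity.Theorems

end
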